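import Summits.ABC.IUTFork.Thm311RealArchInd1Strip
import Summits.ABC.IUTFork.Thm311RealArchInd2Print
import HarnessLib

/-!
# [IUTchIII] Theorem 3.11 (i) (Ind1) at `v ∈ 𝕍^arc`, PRINT-LITERAL, part 2: PRINT'S ARCHIMEDEAN STRIP PART on the real
# log-shell carrier `K_w` is EXACTLY `{1, −1}` — equal to abc-iut-c312-5's typed archimedean (Ind2) slot, strictly between
# Dupuy–Hilado's `{1}` and print's archimedean (Ind2) Klein four-group

Record file (D-0012) of the abc-iut cell (WAVE-4 D-0067 cone-interior discharge prover, seat abc-iut-w4-d001, gen 6;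
home layer L6; D-0079 letter L-K «cone unconditional», row «R9-ARCH»; GO abc-iut-c312-1 15:59:52Z); TAKES NO SIDE on
[IUTchIII] Cor. 3.12. Sequel of `Thm311RealArchInd1Strip.lean` (part 1: every lift to `C~` of a `𝕋𝕄⊢`-automorphism of
any model `M` of `†𝒟⊢_w` is a sign `±1`, `Real.IsCoverLift.exists_sign`; `−1` attained by complex conjugation of the
genuine `(𝒪^▷_ℂ, (0,1])`, `Real.isCoverLift_conj`) and of this seat's `Thm311RealArchInd2Print` (print's (Ind2) at
`∞` = the Klein four-group `Real.ismPrintArch`).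

PRINT (as in part 1): [IUTchIII] Thm. 3.11 (i) (Ind1) p. 154; [IUTchI] Def. 4.1 (iii) (b), (iv) p. 96 (`†𝒟⊢_v ∈ Ob(𝕋𝕄⊢)`
at `v ∈ 𝕍^arc`; morphisms of strips componentwise); [AbsTopIII] Prop. 5.8 (iv), (v) p. 140 (`k~(G) := C~ × C~`,
`ℐ(G) = {(a·x, b·x) | x ∈ ℐ_{C~}, a² + b² = 1}`, "functorial [i.e., relative to `𝕋𝕄⊢`]").

TYPED (no `Prop`-valued fact, no instance, no notation):
* `Real.RealisesArch w ψ L` — «the `ℚ`-linear automorphism `ψ` of abc-iut-c312-5's carrier `K_w` (`Real.Carrier (inl w)`)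
  IS the diagonal action `(L, L)` on `k~(G) = C~ × C~ = ℝ × ℝ`» under the identification `K_w ↪ ℂ = ℝ ⊕ ℝ·i` (Mathlib
  `extensionEmbedding`) by which the cell's archimedean log-shell `Real.shell (inl w)` = the closed ball of radius `π` IS
  print's `ℐ(G)` (c312-5 `Real.shell_inl`; abc-iut-L6-t3 `arcLogShell`);
* **`Real.ind1StripArch w`** — PRINT'S (Ind1) STRIP PART AT THE ARCHIMEDEAN PLACE `w`: the bicontinuous `ℚ`-linear
  automorphisms of `K_w` realising the lift of SOME `𝕋𝕄⊢`-automorphism of SOME object `M ∈ Ob(𝕋𝕄⊢)` (any model of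
  `†𝒟⊢_w` — print: "an object of the category `𝕋𝕄⊢`") read through ANY bicontinuous chart `e`.

PROVED:
* **`Real.ind1StripArch_eq`**: `ind1StripArch w = {1, −1}` — hence **`Real.ind1StripArch_eq_ismDH`** (print's archimedean
  (Ind1) strip part COINCIDES with abc-iut-c312-5's typed archimedean (Ind2) slot `Real.ismDH (inl w) = {1, −1}`),
  `Real.stripAutDH_ssubset_ind1StripArch` (Dupuy–Hilado's trivialised strip slot `{1}` is a PROPER subset at EVERY
  infinite place — CONTRAST with abc-iut-c312-1's finite-place `Real.neg_not_mem_ind1StripOf`: `−1 ∉` print's (Ind1)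
  strip part at `v ∈ 𝕍^non`, `∈` at `v ∈ 𝕍^arc`), **`Real.ind1StripArch_subset_ismPrintArch`** (`⊆` the Klein
  four-group of print's archimedean (Ind2)) and `Real.conjCarrier_not_mem_ind1StripArch` (complex conjugation OF `K_w` is
  NOT a strip automorphism: the strip part acts diagonally `(σ, σ)`, conjugation is `(1, −1)` — an (Ind2) element only),
  `Real.ind1StripArch_ssubset_ismPrintArch`; `Real.image_shell_eq_of_mem_ind1StripArch` (the strip part preserves the
  archimedean log-shell — `±1` are isometries; archimedean analogue of c312-1's `Real.image_shell_eq_of_mem_ind1StripOf`).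

CONSEQUENCE FOR THE RECORD (no new theorem needed): since print's archimedean strip part equals the typed `Real.ismDH (inl w)`
and print's finite strip part lies in `Real.ismDH (inr v)` (c312-1 `Real.ind1Strip_subset_ismDH`), print's FULL (Ind1)
strip slot acts, at every place, through the typed Dupuy–Hilado (Ind2) slot; every `∀`-clause / hull countermodel over
`ismDH` (or over this seat's larger `ismPrintArch`) transfers to print's reading of (Ind1) at ALL places.

HONEST SCOPE: a statement about OUR typed objects at ONE place; both elements `±1` are isometries of `K_w`, so no
archimedean log-volume or integral structure of the cell's instantiation changes (`Real.preimage_archPkHermitian_of_mem_Ind2`,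
`Thm311RealArchHermitianIndDH`); at a real place (`K_w = ℝ`; none under print's `√−1 ∈ F`) the definition reads `ψ = L` on
the one real coordinate; the capsule-index permutations of (Ind1) stay abc-iut-c312-1's `LogShells.Ind1`. Nothing here
asserts or refutes [IUTchIII] Cor. 3.12. [claim: Mochizuki2012, status: disputed] for every quotation of [IUTchI–III];
[cite: MochizukiAbsTopIII2015, Proposition 5.8 (iv)(v) p.140]; [cite: DupuyHilado2025, §4.7]. typed ≠ proved;
instantiated ≠ endorsed.
-/

set_option autoImplicit false

noncomputable section

namespace Summit.ABC.IUTFork.Thm311.Real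

open NumberField Literature.IUT.LogVolume Literature.IUT.LogThetaLattice
open Literature.AnabelianGeometry.AbsoluteAnabelian Complex
open scoped ComplexConjugate

/-! ## 3. Realisation on abc-iut-c312-5's carrier `K_w` and PRINT'S archimedean (Ind1) strip part -/

variable {F : Type} [Field F] [NumberField F]

/-- **REALISATION** of a lift `L` on the carrier `K_w = log(†𝒟⊢_w)` of the real instantiation: under `K_w ↪ ℂ = ℝ ⊕ ℝ·i`
(`extensionEmbedding`; the identification by which `Real.shell (inl w)` — the closed ball of radius `π` — is print's
`ℐ(G) = {(a·x, b·x) | x ∈ ℐ_{C~}, a² + b² = 1} ⊆ k~(G) = C~ × C~`), `ψ` acts as `(L, L)` on the two real coordinates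
(the DIAGONAL action of the functorial lift on `k~(G) = C~ × C~`). A predicate with parameters (no fact).
[claim: Mochizuki2012, status: disputed] -/
def RealisesArch (w : InfinitePlace F) (ψ : Carrier (.inl w : Place F) ≃ₗ[ℚ] Carrier (.inl w : Place F))
    (L : ℝ →+ ℝ) : Prop :=
  ∀ a : Carrier (.inl w : Place F),
    InfinitePlace.Completion.extensionEmbedding w (ψ a) =
      ((L (InfinitePlace.Completion.extensionEmbedding w a).re : ℝ) : ℂ) +
        ((L (InfinitePlace.Completion.extensionEmbedding w a).im : ℝ) : ℂ) * I

/-- **PRINT'S (Ind1) STRIP PART AT THE ARCHIMEDEAN PLACE `w`**: the bicontinuous `ℚ`-linear automorphisms `ψ` of `K_w`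
that realise THE lift to `C~` of some `𝕋𝕄⊢`-automorphism `φ` of some object `M ∈ Ob(𝕋𝕄⊢)` (a model of `†𝒟⊢_w`,
[IUTchI] Def. 4.1 (iii) (b)) read through some bicontinuous chart `e : C ≅ 𝒪^▷_ℂ` ([AbsTopIII] Prop. 5.8 (iv)(v)
functoriality). [claim: Mochizuki2012, status: disputed] -/
def ind1StripArch (w : InfinitePlace F) : Set (Carrier (.inl w : Place F) ≃ₗ[ℚ] Carrier (.inl w : Place F)) :=
  {ψ | Continuous ψ ∧ Continuous ψ.symm ∧
    ∃ (M : TMMono.{0}) (e : M.C ≃* complexIntegralMonoid) (_ : Continuous e) (_ : Continuous e.symm)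
      (φ : TMMono.Iso M M) (L : ℝ →+ ℝ), IsCoverLift M e φ L ∧ RealisesArch w ψ L}

/-- The identity realises the identity lift. [folklore] -/
theorem realisesArch_refl (w : InfinitePlace F) :
    RealisesArch w (LinearEquiv.refl ℚ (Carrier (.inl w : Place F))) (AddMonoidHom.id ℝ) := fun a => by
  rw [LinearEquiv.refl_apply, AddMonoidHom.id_apply, AddMonoidHom.id_apply, Complex.re_add_im]

/-- `−1` realises the lift `t ↦ −t`. [folklore] -/
theorem realisesArch_neg (w : InfinitePlace F) :
    RealisesArch w (LinearEquiv.neg ℚ (M := Carrier (.inl w : Place F))) (-(AddMonoidHom.id ℝ)) := fun a => by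
  have hneg : InfinitePlace.Completion.extensionEmbedding w (-a) =
      -InfinitePlace.Completion.extensionEmbedding w a := map_neg _ a
  rw [LinearEquiv.neg_apply, hneg, AddMonoidHom.neg_apply, AddMonoidHom.neg_apply, AddMonoidHom.id_apply,
    AddMonoidHom.id_apply, Complex.ofReal_neg, Complex.ofReal_neg, neg_mul, ← neg_add, Complex.re_add_im]

/-- A realisation of a SIGN lift is that sign on `K_w`: `σ = 1` gives the identity, `σ = −1` gives `−1`
(`extensionEmbedding` is injective). [folklore] -/
theorem eq_refl_or_neg_of_realisesArch {w : InfinitePlace F}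
    {ψ : Carrier (.inl w : Place F) ≃ₗ[ℚ] Carrier (.inl w : Place F)} {L : ℝ →+ ℝ} {σ : ℝ} (hσ : σ = 1 ∨ σ = -1)
    (hL : ∀ t, L t = σ * t) (h : RealisesArch w ψ L) :
    ψ = LinearEquiv.refl ℚ _ ∨ ψ = LinearEquiv.neg ℚ := by
  rcases hσ with rfl | rfl
  · refine Or.inl (LinearEquiv.ext fun a => ?_)
    apply (InfinitePlace.Completion.extensionEmbedding w).injective
    rw [h a, hL, hL, one_mul, one_mul, LinearEquiv.refl_apply, Complex.re_add_im]
  · refine Or.inr (LinearEquiv.ext fun a => ?_)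
    apply (InfinitePlace.Completion.extensionEmbedding w).injective
    have hneg : InfinitePlace.Completion.extensionEmbedding w (-a) =
        -InfinitePlace.Completion.extensionEmbedding w a := map_neg _ a
    rw [h a, hL, hL, neg_mul, one_mul, neg_mul, one_mul, LinearEquiv.neg_apply, hneg, Complex.ofReal_neg,
      Complex.ofReal_neg, neg_mul, ← neg_add, Complex.re_add_im]

/-- **Every element of print's archimedean (Ind1) strip part is `1` or `−1`.** [claim: Mochizuki2012, status: disputed] -/
theorem eq_refl_or_neg_of_mem_ind1StripArch {w : InfinitePlace F}
    {ψ : Carrier (.inl w : Place F) ≃ₗ[ℚ] Carrier (.inl w : Place F)} (hψ : ψ ∈ ind1StripArch w) :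
    ψ = LinearEquiv.refl ℚ _ ∨ ψ = LinearEquiv.neg ℚ := by
  obtain ⟨-, -, M, e, he, he', φ, L, hlift, hreal⟩ := hψ
  obtain ⟨σ, hσ, hL⟩ := hlift.exists_sign he he'
  exact eq_refl_or_neg_of_realisesArch hσ hL hreal

/-- `1 ∈` print's archimedean (Ind1) strip part (the identity of `𝒟⊢_w`). [claim: Mochizuki2012, status: disputed] -/
theorem refl_mem_ind1StripArch (w : InfinitePlace F) :
    LinearEquiv.refl ℚ (Carrier (.inl w : Place F)) ∈ ind1StripArch w :=
  ⟨continuous_id, continuous_id, archSplitModel, MulEquiv.refl _, continuous_id, continuous_id,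
    TMMono.Iso.refl _, AddMonoidHom.id ℝ, isCoverLift_refl _ _, realisesArch_refl w⟩

/-- **`−1 ∈` print's archimedean (Ind1) strip part** — realised by complex conjugation of the split monoid `(𝒪^▷_ℂ, (0,1])`,
whose lift to `C~` is `t ↦ −t` on BOTH factors of `k~(G) = C~ × C~`. CONTRAST: at a finite place `−1 ∉` print's (Ind1)
strip part (abc-iut-c312-1 `Real.neg_not_mem_ind1StripOf`, Galois-equivariant lifts are norm-rigid).
[claim: Mochizuki2012, status: disputed] -/
theorem neg_mem_ind1StripArch (w : InfinitePlace F) :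
    LinearEquiv.neg ℚ (M := Carrier (.inl w : Place F)) ∈ ind1StripArch w :=
  ⟨continuous_neg, continuous_neg, archSplitModel, MulEquiv.refl _, continuous_id, continuous_id,
    archSplitModelConj, -(AddMonoidHom.id ℝ), isCoverLift_conj, realisesArch_neg w⟩

/-- **PRINT'S ARCHIMEDEAN (Ind1) STRIP PART IS EXACTLY `{1, −1}`.** [claim: Mochizuki2012, status: disputed] -/
theorem ind1StripArch_eq (w : InfinitePlace F) :
    ind1StripArch w = {LinearEquiv.refl ℚ (Carrier (.inl w : Place F)), LinearEquiv.neg ℚ} := by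
  ext ψ
  constructor
  · intro h
    rcases eq_refl_or_neg_of_mem_ind1StripArch h with rfl | rfl
    · exact Or.inl rfl
    · exact Or.inr rfl
  · rintro (rfl | rfl)
    · exact refl_mem_ind1StripArch w
    · exact neg_mem_ind1StripArch w

/-- **Print's archimedean (Ind1) strip part COINCIDES with abc-iut-c312-5's typed archimedean (Ind2) slot**
`Real.ismDH logv (inl w) = {1, −1}` (for every log-binder `logv`; the archimedean slots do not read it).
[claim: Mochizuki2012, status: disputed] -/
theorem ind1StripArch_eq_ismDH (logv : PadicLogs F) (w : InfinitePlace F) :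
    ind1StripArch w = ismDH logv (.inl w : Place F) := by
  rw [ind1StripArch_eq]; rfl

/-- Dupuy–Hilado's trivialised strip slot `{1}` lies in print's archimedean strip part. [cite: DupuyHilado2025, §4.7] -/
theorem stripAutDH_subset_ind1StripArch (w : InfinitePlace F) : stripAutDH (.inl w : Place F) ⊆ ind1StripArch w := by
  intro φ hφ
  rw [show φ = LinearEquiv.refl ℚ (Carrier (.inl w : Place F)) from hφ]
  exact refl_mem_ind1StripArch w

/-- `−1 ≠ 1` on `K_w` (characteristic `0`). [folklore] -/
theorem neg_ne_refl (w : InfinitePlace F) :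
    LinearEquiv.neg ℚ (M := Carrier (.inl w : Place F)) ≠ LinearEquiv.refl ℚ _ := by
  intro h
  have h1 := LinearEquiv.congr_fun h (1 : Carrier (.inl w : Place F))
  rw [LinearEquiv.neg_apply, LinearEquiv.refl_apply] at h1
  have h2 : (2 : Carrier (.inl w : Place F)) = 0 := by linear_combination -h1
  exact two_ne_zero h2

/-- **DH's `{1}` is a PROPER subset of print's archimedean strip part** (`−1` is a strip automorphism at `∞`).
[cite: DupuyHilado2025, §4.7] [claim: Mochizuki2012, status: disputed] -/
theorem stripAutDH_ssubset_ind1StripArch (w : InfinitePlace F) : stripAutDH (.inl w : Place F) ⊂ ind1StripArch w := by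
  refine ⟨stripAutDH_subset_ind1StripArch w, fun h => neg_ne_refl w ?_⟩
  exact h (neg_mem_ind1StripArch w)

/-- **Print's archimedean (Ind1) strip part `⊆` print's archimedean (Ind2)** (the Klein four-group `{1, −1, conj, −conj}` of
`Thm311RealArchInd2Print`). [claim: Mochizuki2012, status: disputed] -/
theorem ind1StripArch_subset_ismPrintArch (logv : PadicLogs F) (w : InfinitePlace F) :
    ind1StripArch w ⊆ ismPrintArch logv (.inl w : Place F) := by
  rw [ind1StripArch_eq_ismDH logv]
  exact ismDH_subset_ismPrintArch logv (.inl w)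

/-- **Complex conjugation of `K_w` is NOT a strip automorphism** (at a complex place): the strip part acts on
`k~(G) = C~ × C~` diagonally by `(σ, σ)`, conjugation is `(1, −1)` — an element of print's (Ind2) only.
[claim: Mochizuki2012, status: disputed] -/
theorem conjCarrier_not_mem_ind1StripArch {w : InfinitePlace F} (hw : w.IsComplex) : conjCarrier w ∉ ind1StripArch w := by
  intro h
  rcases eq_refl_or_neg_of_mem_ind1StripArch h with h1 | h1
  · exact conjCarrier_ne_refl hw h1
  · exact conjCarrier_ne_neg hw h1

/-- At a complex place print's archimedean (Ind1) strip part is a PROPER subset of print's archimedean (Ind2).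
[claim: Mochizuki2012, status: disputed] -/
theorem ind1StripArch_ssubset_ismPrintArch (logv : PadicLogs F) {w : InfinitePlace F} (hw : w.IsComplex) :
    ind1StripArch w ⊂ ismPrintArch logv (.inl w : Place F) := by
  refine ⟨ind1StripArch_subset_ismPrintArch logv w, fun h => conjCarrier_not_mem_ind1StripArch hw ?_⟩
  exact h (Or.inr (Or.inr (Or.inl rfl)))

/-- Every element of print's archimedean strip part preserves the archimedean log-shell (`±1` are isometries of `K_w`):
the strip part, too, acts through lattice/ball-preserving maps — the archimedean analogue of c312-1's
`Real.image_shell_eq_of_mem_ind1StripOf`. [claim: Mochizuki2012, status: disputed] -/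
theorem image_shell_eq_of_mem_ind1StripArch (logv : PadicLogs F) {w : InfinitePlace F}
    {ψ : Carrier (.inl w : Place F) ≃ₗ[ℚ] Carrier (.inl w : Place F)} (hψ : ψ ∈ ind1StripArch w) :
    ψ '' shell logv (.inl w) = shell logv (.inl w) := by
  rw [shell_inl]
  rcases eq_refl_or_neg_of_mem_ind1StripArch hψ with rfl | rfl
  · exact Set.image_id' _
  · ext a
    simp only [Set.mem_image, LinearEquiv.neg_apply, Set.mem_setOf_eq]
    constructor
    · rintro ⟨b, hb, rfl⟩
      rwa [norm_neg]
    · intro ha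
      exact ⟨-a, by rwa [norm_neg], neg_neg a⟩

end Summit.ABC.IUTFork.Thm311.Real

end
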